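import Mathlib

/-!
# First-order Gaussian beams for `u_tt − u_xx + μ² q(x) u = 0`: the exact residual

Topic `Literature/Analysis/PDE` (namespace `Literature.Analysis.PDE`). Everything is proved; no
definitions (the beam is an explicit lambda that users `set`).

Let `X ξ θ : ℝ → ℝ`, `Γ a : ℝ → ℂ` be `C²` and satisfy the phase equations of
`Literature.Analysis.ODE.exists_beamPhase` (`X' = ξ/ω₀`, `2ω₀ξ' = −q'(X)`, `ξ² + q(X) = ω₀²`,
`θ' = −ω₀ + ξX'`, `ω₀Γ' = (ξ' − ΓX')² − Γ² − ½q''(X)`, `2ω₀a' = −((ξ' − ΓX')X' + Γ)a`). For the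
beam `F(t,x) = a(t) exp(iμΦ(t,x))`, `Φ = θ + ξy + ½Γy²`, `y = x − X(t)`, this file computes the slice
derivatives (`hasDerivAt_beam_t`, `iteratedDeriv_beam_t`, `iteratedDeriv_beam_x`) and proves the
EXACT RESIDUAL IDENTITY of the first-order beam (the orders `y⁰, y¹, y²` of the eikonal bracket and
the order `y⁰` of the transport bracket vanish by the six equations; `beam_residual_algebra` is
that cancellation as a polynomial identity):

  `F_tt − F_xx + μ²q F = e^{iμΦ} · [ μ² a 𝓔 + iμ (T₁ y + T₂ y²) + a'' ]`,     (`beam_residual`)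
  `𝓔 = −A₁Γ′y³ − ¼Γ′²y⁴ + (q(X+y) − q(X) − q′(X)y − ½q″(X)y²)`,  `A₁ = ξ′ − ΓX′`,
  `T₁ = 2A₁a′ + (ξ″ − 2Γ′X′ − ΓX″)a`,  `T₂ = Γ′a′ + ½Γ″a`,

in the `iteratedDeriv`-slice vocabulary of the tree's one-dimensional wave files (its real part,
the joint `C²` regularity and the `L²` bounds are in `GaussianBeam1DRealPart.lean`). Since `|e^{iμΦ}| = e^{−μ Im Γ y²/2}`, the residual is `O(μ^{1/4})` in `L²(dx)` while the beam has
energy `≍ μ^{3/2}`.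

## References

* J. Ralston, *Gaussian beams and the propagation of singularities*, MAA Stud. Math. 23 (1982)
  206–248, §2 (first-order beams: eikonal to second order on the ray, transport to order zero).
  Key `Ralston1982`.
* J. Sbierski, Anal. PDE 8 (2015) 1379–1420, §3 (arXiv:1311.2477v2 §2.2–2.3). Key `Sbierski2015`.
-/

noncomputable section

namespace Literature.Analysis.PDE

open Set Filter Topology Complex

/-! ### The algebraic identity behind the residual -/

/-- **The residual identity as pure algebra.** With the symbols of one space-time point
(`θ₁ = θ′`, `θ₂ = θ″`, `ξ₀ = ξ`, …, `y = x − X`, `qX = q(X)`, `q₁ = q′(X)`, `q₂ = q″(X)`,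
`Qy = q(X + y)`) and the six phase relations, the combination `F_tt − F_xx + μ²Qy·F` divided by
`e^{iμΦ}` equals `μ²a𝓔 + iμ(T₁y + T₂y²) + a₂`. [cite: Ralston1982, §2] -/
theorem beam_residual_algebra
    (μ ω₀ θ₁ θ₂ ξ₀ ξ₁ ξ₂ X₁ X₂ y qX q₁ q₂ Qy : ℂ) (Γ₀ Γ₁ Γ₂ a₀ a₁ a₂ : ℂ)
    (hcons : ξ₀ ^ 2 + qX = ω₀ ^ 2) (hθ : θ₁ = -ω₀ + ξ₀ * X₁) (hθ₂ : θ₂ = ξ₁ * X₁ + ξ₀ * X₂)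
    (hX : ω₀ * X₁ = ξ₀) (hξ : 2 * ω₀ * ξ₁ = -q₁)
    (hΓ : ω₀ * Γ₁ = (ξ₁ - Γ₀ * X₁) ^ 2 - Γ₀ ^ 2 - q₂ / 2)
    (ha : 2 * ω₀ * a₁ = -((ξ₁ - Γ₀ * X₁) * X₁ + Γ₀) * a₀) :
    let Φt : ℂ := θ₁ + ξ₁ * y - ξ₀ * X₁ + Γ₁ / 2 * y ^ 2 - Γ₀ * y * X₁
    let Φtt : ℂ := θ₂ + ξ₂ * y - 2 * ξ₁ * X₁ - ξ₀ * X₂ + Γ₂ / 2 * y ^ 2 - 2 * Γ₁ * y * X₁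
      + Γ₀ * X₁ ^ 2 - Γ₀ * y * X₂
    let Φx : ℂ := ξ₀ + Γ₀ * y
    (a₂ + 2 * (I * μ * Φt) * a₁ + a₀ * (I * μ * Φtt + (I * μ * Φt) ^ 2))
      - a₀ * (I * μ * Γ₀ + (I * μ * Φx) ^ 2) + μ ^ 2 * Qy * a₀
    = μ ^ 2 * a₀ * (-(ξ₁ - Γ₀ * X₁) * Γ₁ * y ^ 3 - Γ₁ ^ 2 / 4 * y ^ 4
          + (Qy - qX - q₁ * y - q₂ / 2 * y ^ 2))
      + I * μ * ((2 * (ξ₁ - Γ₀ * X₁) * a₁ + (ξ₂ - 2 * Γ₁ * X₁ - Γ₀ * X₂) * a₀) * y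
          + (Γ₁ * a₁ + Γ₂ / 2 * a₀) * y ^ 2)
      + a₂ := by
  intro Φt Φtt Φx
  have hI : I ^ 2 = -1 := Complex.I_sq
  simp only [Φt, Φtt, Φx]
  linear_combination (μ ^ 2 * a₀) * hcons
    - (μ ^ 2 * a₀ * (θ₁ - ξ₀ * X₁ - ω₀) + 2 * μ ^ 2 * a₀ * (ξ₁ - Γ₀ * X₁) * y
        + μ ^ 2 * a₀ * y ^ 2 * Γ₁ - 2 * I * μ * a₁) * hθ
    + I * μ * a₀ * hθ₂ - 2 * μ ^ 2 * a₀ * Γ₀ * y * hX + μ ^ 2 * a₀ * y * hξ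
    + μ ^ 2 * a₀ * y ^ 2 * hΓ - I * μ * ha
    + (a₀ * μ ^ 2 * (θ₁ + ξ₁ * y - ξ₀ * X₁ + Γ₁ / 2 * y ^ 2 - Γ₀ * y * X₁) ^ 2
        - a₀ * μ ^ 2 * (ξ₀ + Γ₀ * y) ^ 2) * hI

/-! ### Slice derivatives of the beam `F(τ, x) = a(τ) exp(iμΦ(τ, x))` -/

section Slices

variable {X ξ θ : ℝ → ℝ} {Γ a : ℝ → ℂ} {μ : ℝ}

/-- `t`-derivative of the phase slice `τ ↦ Φ(τ, x)`. [folklore] -/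
theorem hasDerivAt_beamPhase_t (hX : ContDiff ℝ 1 X) (hξ : ContDiff ℝ 1 ξ) (hθ : ContDiff ℝ 1 θ)
    (hΓ : ContDiff ℝ 1 Γ) (x t : ℝ) :
    HasDerivAt (fun τ => (θ τ : ℂ) + (ξ τ : ℂ) * ((x : ℂ) - X τ) + Γ τ / 2 * ((x : ℂ) - X τ) ^ 2)
      (((deriv θ t : ℝ) : ℂ) + ((deriv ξ t : ℝ) : ℂ) * ((x : ℂ) - X t) - (ξ t : ℂ) * ((deriv X t : ℝ) : ℂ)
        + deriv Γ t / 2 * ((x : ℂ) - X t) ^ 2 - Γ t * ((x : ℂ) - X t) * ((deriv X t : ℝ) : ℂ)) t := by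
  have hθ' : HasDerivAt (fun τ => (θ τ : ℂ)) ((deriv θ t : ℝ) : ℂ) t :=
    ((hθ.differentiable one_ne_zero t).hasDerivAt).ofReal_comp
  have hξ' : HasDerivAt (fun τ => (ξ τ : ℂ)) ((deriv ξ t : ℝ) : ℂ) t :=
    ((hξ.differentiable one_ne_zero t).hasDerivAt).ofReal_comp
  have hX' : HasDerivAt (fun τ => (x : ℂ) - X τ) (-((deriv X t : ℝ) : ℂ)) t :=
    (((hX.differentiable one_ne_zero t).hasDerivAt).ofReal_comp).const_sub _
  have hΓ' : HasDerivAt Γ (deriv Γ t) t := (hΓ.differentiable one_ne_zero t).hasDerivAt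
  have h := (hθ'.add (hξ'.mul hX')).add ((hΓ'.div_const 2).mul (hX'.pow 2))
  refine h.congr_deriv ?_
  simp only [Nat.cast_ofNat, Pi.pow_apply]
  ring

/-- **First `t`-derivative of the beam slice**: `F_t = (a′ + iμΦ_t a) e^{iμΦ}`. [cite: Ralston1982, §2] -/
theorem hasDerivAt_beam_t (hX : ContDiff ℝ 1 X) (hξ : ContDiff ℝ 1 ξ) (hθ : ContDiff ℝ 1 θ)
    (hΓ : ContDiff ℝ 1 Γ) (ha : ContDiff ℝ 1 a) (x t : ℝ) :
    HasDerivAt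
      (fun τ => a τ * cexp (I * μ * ((θ τ : ℂ) + (ξ τ : ℂ) * ((x : ℂ) - X τ)
        + Γ τ / 2 * ((x : ℂ) - X τ) ^ 2)))
      ((deriv a t + I * μ * (((deriv θ t : ℝ) : ℂ) + ((deriv ξ t : ℝ) : ℂ) * ((x : ℂ) - X t)
          - (ξ t : ℂ) * ((deriv X t : ℝ) : ℂ) + deriv Γ t / 2 * ((x : ℂ) - X t) ^ 2
          - Γ t * ((x : ℂ) - X t) * ((deriv X t : ℝ) : ℂ)) * a t)
        * cexp (I * μ * ((θ t : ℂ) + (ξ t : ℂ) * ((x : ℂ) - X t) + Γ t / 2 * ((x : ℂ) - X t) ^ 2)))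
      t := by
  have hP := hasDerivAt_beamPhase_t hX hξ hθ hΓ x t
  have hE := (hP.const_mul (I * μ)).cexp
  have ha' : HasDerivAt a (deriv a t) t := (ha.differentiable one_ne_zero t).hasDerivAt
  have h := ha'.mul hE
  refine h.congr_deriv ?_
  ring

/-- **Second `t`-derivative of the beam slice**:
`F_tt = [a″ + 2iμΦ_t a′ + a(iμΦ_tt + (iμΦ_t)²)] e^{iμΦ}`, with
`Φ_tt = θ″ + ξ″y − 2ξ′X′ − ξX″ + ½Γ″y² − 2Γ′yX′ + ΓX′² − ΓyX″`. [cite: Ralston1982, §2] -/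
theorem iteratedDeriv_beam_t (hX : ContDiff ℝ 2 X) (hξ : ContDiff ℝ 2 ξ) (hθ : ContDiff ℝ 2 θ)
    (hΓ : ContDiff ℝ 2 Γ) (ha : ContDiff ℝ 2 a) (x t : ℝ) :
    iteratedDeriv 2
      (fun τ => a τ * cexp (I * μ * ((θ τ : ℂ) + (ξ τ : ℂ) * ((x : ℂ) - X τ)
        + Γ τ / 2 * ((x : ℂ) - X τ) ^ 2))) t
    = (deriv (deriv a) t
        + 2 * (I * μ * (((deriv θ t : ℝ) : ℂ) + ((deriv ξ t : ℝ) : ℂ) * ((x : ℂ) - X t)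
            - (ξ t : ℂ) * ((deriv X t : ℝ) : ℂ) + deriv Γ t / 2 * ((x : ℂ) - X t) ^ 2
            - Γ t * ((x : ℂ) - X t) * ((deriv X t : ℝ) : ℂ))) * deriv a t
        + a t * (I * μ * (((deriv (deriv θ) t : ℝ) : ℂ) + ((deriv (deriv ξ) t : ℝ) : ℂ) * ((x : ℂ) - X t)
              - 2 * ((deriv ξ t : ℝ) : ℂ) * ((deriv X t : ℝ) : ℂ) - (ξ t : ℂ) * ((deriv (deriv X) t : ℝ) : ℂ)
              + deriv (deriv Γ) t / 2 * ((x : ℂ) - X t) ^ 2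
              - 2 * deriv Γ t * ((x : ℂ) - X t) * ((deriv X t : ℝ) : ℂ)
              + Γ t * ((deriv X t : ℝ) : ℂ) ^ 2 - Γ t * ((x : ℂ) - X t) * ((deriv (deriv X) t : ℝ) : ℂ))
            + (I * μ * (((deriv θ t : ℝ) : ℂ) + ((deriv ξ t : ℝ) : ℂ) * ((x : ℂ) - X t)
              - (ξ t : ℂ) * ((deriv X t : ℝ) : ℂ) + deriv Γ t / 2 * ((x : ℂ) - X t) ^ 2
              - Γ t * ((x : ℂ) - X t) * ((deriv X t : ℝ) : ℂ))) ^ 2))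
      * cexp (I * μ * ((θ t : ℂ) + (ξ t : ℂ) * ((x : ℂ) - X t) + Γ t / 2 * ((x : ℂ) - X t) ^ 2)) := by
  have hX1 : ContDiff ℝ 1 X := hX.of_le (by norm_num)
  have hξ1 : ContDiff ℝ 1 ξ := hξ.of_le (by norm_num)
  have hθ1 : ContDiff ℝ 1 θ := hθ.of_le (by norm_num)
  have hΓ1 : ContDiff ℝ 1 Γ := hΓ.of_le (by norm_num)
  have ha1 : ContDiff ℝ 1 a := ha.of_le (by norm_num)
  have hdX1 : ContDiff ℝ 1 (deriv X) := hX.deriv'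
  have hdξ1 : ContDiff ℝ 1 (deriv ξ) := hξ.deriv'
  have hdθ1 : ContDiff ℝ 1 (deriv θ) := hθ.deriv'
  have hdΓ1 : ContDiff ℝ 1 (deriv Γ) := hΓ.deriv'
  have hda1 : ContDiff ℝ 1 (deriv a) := ha.deriv'
  -- first derivative as a function
  have h1 : deriv (fun τ => a τ * cexp (I * μ * ((θ τ : ℂ) + (ξ τ : ℂ) * ((x : ℂ) - X τ)
        + Γ τ / 2 * ((x : ℂ) - X τ) ^ 2)))
      = fun τ => (deriv a τ + I * μ * (((deriv θ τ : ℝ) : ℂ) + ((deriv ξ τ : ℝ) : ℂ) * ((x : ℂ) - X τ)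
          - (ξ τ : ℂ) * ((deriv X τ : ℝ) : ℂ) + deriv Γ τ / 2 * ((x : ℂ) - X τ) ^ 2
          - Γ τ * ((x : ℂ) - X τ) * ((deriv X τ : ℝ) : ℂ)) * a τ)
        * cexp (I * μ * ((θ τ : ℂ) + (ξ τ : ℂ) * ((x : ℂ) - X τ) + Γ τ / 2 * ((x : ℂ) - X τ) ^ 2)) :=
    funext fun τ => (hasDerivAt_beam_t hX1 hξ1 hθ1 hΓ1 ha1 x τ).deriv
  rw [iteratedDeriv_succ, iteratedDeriv_one, h1]
  -- ingredients at `t`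
  have ofR : ∀ {f : ℝ → ℝ}, ContDiff ℝ 1 f →
      HasDerivAt (fun τ => (f τ : ℂ)) ((deriv f t : ℝ) : ℂ) t := fun hf =>
    ((hf.differentiable one_ne_zero t).hasDerivAt).ofReal_comp
  have hθ' := ofR hθ1
  have hdθ' := ofR hdθ1
  have hξ' := ofR hξ1
  have hdξ' := ofR hdξ1
  have hdX' := ofR hdX1
  have hX' : HasDerivAt (fun τ => (x : ℂ) - X τ) (-((deriv X t : ℝ) : ℂ)) t := (ofR hX1).const_sub _
  have hΓ' : HasDerivAt Γ (deriv Γ t) t := (hΓ1.differentiable one_ne_zero t).hasDerivAt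
  have hdΓ' : HasDerivAt (deriv Γ) (deriv (deriv Γ) t) t := (hdΓ1.differentiable one_ne_zero t).hasDerivAt
  have ha' : HasDerivAt a (deriv a t) t := (ha1.differentiable one_ne_zero t).hasDerivAt
  have hda' : HasDerivAt (deriv a) (deriv (deriv a) t) t := (hda1.differentiable one_ne_zero t).hasDerivAt
  -- the phase slice and its derivative
  have hP := hasDerivAt_beamPhase_t hX1 hξ1 hθ1 hΓ1 x t
  have hE := (hP.const_mul (I * μ)).cexp
  -- `Φ_t` as a function of `τ` and its derivative
  have hPt : HasDerivAt (fun τ => ((deriv θ τ : ℝ) : ℂ) + ((deriv ξ τ : ℝ) : ℂ) * ((x : ℂ) - X τ)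
        - (ξ τ : ℂ) * ((deriv X τ : ℝ) : ℂ) + deriv Γ τ / 2 * ((x : ℂ) - X τ) ^ 2
        - Γ τ * ((x : ℂ) - X τ) * ((deriv X τ : ℝ) : ℂ))
      (((deriv (deriv θ) t : ℝ) : ℂ) + ((deriv (deriv ξ) t : ℝ) : ℂ) * ((x : ℂ) - X t)
        - 2 * ((deriv ξ t : ℝ) : ℂ) * ((deriv X t : ℝ) : ℂ) - (ξ t : ℂ) * ((deriv (deriv X) t : ℝ) : ℂ)
        + deriv (deriv Γ) t / 2 * ((x : ℂ) - X t) ^ 2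
        - 2 * deriv Γ t * ((x : ℂ) - X t) * ((deriv X t : ℝ) : ℂ)
        + Γ t * ((deriv X t : ℝ) : ℂ) ^ 2 - Γ t * ((x : ℂ) - X t) * ((deriv (deriv X) t : ℝ) : ℂ)) t := by
    have h := (((hdθ'.add (hdξ'.mul hX')).sub (hξ'.mul hdX')).add
      ((hdΓ'.div_const 2).mul (hX'.pow 2))).sub ((hΓ'.mul hX').mul hdX')
    refine h.congr_deriv ?_
    simp only [Nat.cast_ofNat, Pi.pow_apply, Pi.mul_apply]
    ring
  have h : HasDerivAt (fun τ => (deriv a τ + I * μ * (((deriv θ τ : ℝ) : ℂ)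
          + ((deriv ξ τ : ℝ) : ℂ) * ((x : ℂ) - X τ)
          - (ξ τ : ℂ) * ((deriv X τ : ℝ) : ℂ) + deriv Γ τ / 2 * ((x : ℂ) - X τ) ^ 2
          - Γ τ * ((x : ℂ) - X τ) * ((deriv X τ : ℝ) : ℂ)) * a τ)
        * cexp (I * μ * ((θ τ : ℂ) + (ξ τ : ℂ) * ((x : ℂ) - X τ) + Γ τ / 2 * ((x : ℂ) - X τ) ^ 2))) _ t :=
    (hda'.add ((hPt.const_mul (I * μ)).mul ha')).mul hE
  rw [h.deriv]
  simp only [Pi.add_apply, Pi.mul_apply]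
  ring

/-- `x`-derivative of the beam slice: `F_x = iμ(ξ + Γy) F`. [cite: Ralston1982, §2] -/
theorem hasDerivAt_beam_x (x t : ℝ) :
    HasDerivAt
      (fun y : ℝ => a t * cexp (I * μ * ((θ t : ℂ) + (ξ t : ℂ) * ((y : ℂ) - X t)
        + Γ t / 2 * ((y : ℂ) - X t) ^ 2)))
      (a t * (I * μ * ((ξ t : ℂ) + Γ t * ((x : ℂ) - X t)))
        * cexp (I * μ * ((θ t : ℂ) + (ξ t : ℂ) * ((x : ℂ) - X t) + Γ t / 2 * ((x : ℂ) - X t) ^ 2)))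
      x := by
  have hy : HasDerivAt (fun y : ℝ => (y : ℂ) - X t) 1 x := by
    simpa using ((hasDerivAt_id x).ofReal_comp).sub_const ((X t : ℝ) : ℂ)
  have hP : HasDerivAt (fun y : ℝ => (θ t : ℂ) + (ξ t : ℂ) * ((y : ℂ) - X t)
        + Γ t / 2 * ((y : ℂ) - X t) ^ 2) ((ξ t : ℂ) + Γ t * ((x : ℂ) - X t)) x := by
    have h := ((hy.const_mul (ξ t : ℂ)).const_add (θ t : ℂ)).add ((hy.pow 2).const_mul (Γ t / 2))
    refine h.congr_deriv ?_
    simp only [Nat.cast_ofNat, mul_one]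
    ring
  have h := ((hP.const_mul (I * μ)).cexp).const_mul (a t)
  refine h.congr_deriv ?_
  ring

/-- **Second `x`-derivative of the beam slice**: `F_xx = (iμΓ + (iμ(ξ + Γy))²) F`. [cite: Ralston1982, §2] -/
theorem iteratedDeriv_beam_x (x t : ℝ) :
    iteratedDeriv 2
      (fun y : ℝ => a t * cexp (I * μ * ((θ t : ℂ) + (ξ t : ℂ) * ((y : ℂ) - X t)
        + Γ t / 2 * ((y : ℂ) - X t) ^ 2))) x
    = a t * (I * μ * Γ t + (I * μ * ((ξ t : ℂ) + Γ t * ((x : ℂ) - X t))) ^ 2)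
      * cexp (I * μ * ((θ t : ℂ) + (ξ t : ℂ) * ((x : ℂ) - X t) + Γ t / 2 * ((x : ℂ) - X t) ^ 2)) := by
  have h1 : deriv (fun y : ℝ => a t * cexp (I * μ * ((θ t : ℂ) + (ξ t : ℂ) * ((y : ℂ) - X t)
        + Γ t / 2 * ((y : ℂ) - X t) ^ 2)))
      = fun y : ℝ => (a t * (I * μ * ((ξ t : ℂ) + Γ t * ((y : ℂ) - X t))))
        * cexp (I * μ * ((θ t : ℂ) + (ξ t : ℂ) * ((y : ℂ) - X t) + Γ t / 2 * ((y : ℂ) - X t) ^ 2)) :=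
    funext fun y => (hasDerivAt_beam_x (μ := μ) (X := X) (ξ := ξ) (θ := θ) (Γ := Γ) (a := a) y t).deriv
  rw [iteratedDeriv_succ, iteratedDeriv_one, h1]
  have hy : HasDerivAt (fun y : ℝ => (y : ℂ) - X t) 1 x := by
    simpa using ((hasDerivAt_id x).ofReal_comp).sub_const ((X t : ℝ) : ℂ)
  have hP : HasDerivAt (fun y : ℝ => (θ t : ℂ) + (ξ t : ℂ) * ((y : ℂ) - X t)
        + Γ t / 2 * ((y : ℂ) - X t) ^ 2) ((ξ t : ℂ) + Γ t * ((x : ℂ) - X t)) x := by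
    have h := ((hy.const_mul (ξ t : ℂ)).const_add (θ t : ℂ)).add ((hy.pow 2).const_mul (Γ t / 2))
    refine h.congr_deriv ?_
    simp only [Nat.cast_ofNat, mul_one]
    ring
  have hlin : HasDerivAt (fun y : ℝ => a t * (I * μ * ((ξ t : ℂ) + Γ t * ((y : ℂ) - X t))))
      (a t * (I * μ * Γ t)) x := by
    have h := (((hy.const_mul (Γ t)).const_add (ξ t : ℂ)).const_mul (I * μ)).const_mul (a t)
    refine h.congr_deriv ?_
    ring
  have h : HasDerivAt (fun y : ℝ => (a t * (I * μ * ((ξ t : ℂ) + Γ t * ((y : ℂ) - X t))))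
        * cexp (I * μ * ((θ t : ℂ) + (ξ t : ℂ) * ((y : ℂ) - X t) + Γ t / 2 * ((y : ℂ) - X t) ^ 2))) _ x :=
    hlin.mul ((hP.const_mul (I * μ)).cexp)
  rw [h.deriv]
  ring

end Slices

/-! ### The exact residual -/

section Residual

variable {q : ℝ → ℝ} {X ξ θ : ℝ → ℝ} {Γ a : ℝ → ℂ} {μ ω₀ : ℝ}

/-- **Exact residual of the first-order Gaussian beam.** Under the six phase equations,
`F_tt − F_xx + μ²qF = e^{iμΦ}[μ²a𝓔 + iμ(T₁y + T₂y²) + a″]` with `𝓔` the cubic remainder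
(`−A₁Γ′y³ − ¼Γ′²y⁴ +` the second-order Taylor remainder of `q` at `X`), `T₁ = 2A₁a′ +
(ξ″ − 2Γ′X′ − ΓX″)a`, `T₂ = Γ′a′ + ½Γ″a`, `A₁ = ξ′ − ΓX′`, `y = x − X(t)`.
[cite: Ralston1982, §2 (first-order beam: eikonal to second order, transport to order zero)] -/
theorem beam_residual (hω₀ : ω₀ ≠ 0)
    (hX2 : ContDiff ℝ 2 X) (hξ2 : ContDiff ℝ 2 ξ) (hθ2 : ContDiff ℝ 2 θ) (hΓ2 : ContDiff ℝ 2 Γ)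
    (ha2 : ContDiff ℝ 2 a)
    (hX : ∀ t, deriv X t = ξ t / ω₀) (hξ : ∀ t, deriv ξ t = -(deriv q (X t)) / (2 * ω₀))
    (hcons : ∀ t, ξ t ^ 2 + q (X t) = ω₀ ^ 2) (hθ : ∀ t, deriv θ t = -ω₀ + ξ t * deriv X t)
    (hΓ : ∀ t, (ω₀ : ℂ) * deriv Γ t
      = (((deriv ξ t : ℝ) : ℂ) - Γ t * ((deriv X t : ℝ) : ℂ)) ^ 2 - Γ t ^ 2
        - ((iteratedDeriv 2 q (X t) / 2 : ℝ) : ℂ))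
    (ha : ∀ t, 2 * (ω₀ : ℂ) * deriv a t
      = -((((deriv ξ t : ℝ) : ℂ) - Γ t * ((deriv X t : ℝ) : ℂ)) * ((deriv X t : ℝ) : ℂ) + Γ t) * a t)
    (t x : ℝ) :
    iteratedDeriv 2
        (fun τ => a τ * cexp (I * μ * ((θ τ : ℂ) + (ξ τ : ℂ) * ((x : ℂ) - X τ)
          + Γ τ / 2 * ((x : ℂ) - X τ) ^ 2))) t
      - iteratedDeriv 2
        (fun y : ℝ => a t * cexp (I * μ * ((θ t : ℂ) + (ξ t : ℂ) * ((y : ℂ) - X t)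
          + Γ t / 2 * ((y : ℂ) - X t) ^ 2))) x
      + μ ^ 2 * q x * (a t * cexp (I * μ * ((θ t : ℂ) + (ξ t : ℂ) * ((x : ℂ) - X t)
          + Γ t / 2 * ((x : ℂ) - X t) ^ 2)))
    = cexp (I * μ * ((θ t : ℂ) + (ξ t : ℂ) * ((x : ℂ) - X t) + Γ t / 2 * ((x : ℂ) - X t) ^ 2))
      * (μ ^ 2 * a t
          * (-(((deriv ξ t : ℝ) : ℂ) - Γ t * ((deriv X t : ℝ) : ℂ)) * deriv Γ t * ((x : ℂ) - X t) ^ 3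
            - deriv Γ t ^ 2 / 4 * ((x : ℂ) - X t) ^ 4
            + ((q x - q (X t) - deriv q (X t) * (x - X t)
                - iteratedDeriv 2 q (X t) / 2 * (x - X t) ^ 2 : ℝ) : ℂ))
        + I * μ * ((2 * (((deriv ξ t : ℝ) : ℂ) - Γ t * ((deriv X t : ℝ) : ℂ)) * deriv a t
              + (((deriv (deriv ξ) t : ℝ) : ℂ) - 2 * deriv Γ t * ((deriv X t : ℝ) : ℂ)
                - Γ t * ((deriv (deriv X) t : ℝ) : ℂ)) * a t) * ((x : ℂ) - X t)
            + (deriv Γ t * deriv a t + deriv (deriv Γ) t / 2 * a t) * ((x : ℂ) - X t) ^ 2)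
        + deriv (deriv a) t) := by
  rw [iteratedDeriv_beam_t hX2 hξ2 hθ2 hΓ2 ha2 x t, iteratedDeriv_beam_x x t]
  -- the second derivative of `θ` from its equation
  have hθ₂ : deriv (deriv θ) t = deriv ξ t * deriv X t + ξ t * deriv (deriv X) t := by
    have hfun : deriv θ = fun t => -ω₀ + ξ t * deriv X t := funext hθ
    rw [hfun]
    have hξ' : HasDerivAt ξ (deriv ξ t) t := (hξ2.differentiable two_ne_zero t).hasDerivAt
    have hdX' : HasDerivAt (deriv X) (deriv (deriv X) t) t :=
      ((hX2.deriv').differentiable one_ne_zero t).hasDerivAt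
    exact ((hξ'.mul hdX').const_add (-ω₀)).deriv
  -- the relations in complex form
  have hω₀' : (ω₀ : ℂ) ≠ 0 := by exact_mod_cast hω₀
  have ccons : (ξ t : ℂ) ^ 2 + (q (X t) : ℂ) = (ω₀ : ℂ) ^ 2 := by exact_mod_cast hcons t
  have cθ : ((deriv θ t : ℝ) : ℂ) = -(ω₀ : ℂ) + (ξ t : ℂ) * ((deriv X t : ℝ) : ℂ) := by
    exact_mod_cast hθ t
  have cθ₂ : ((deriv (deriv θ) t : ℝ) : ℂ)
      = ((deriv ξ t : ℝ) : ℂ) * ((deriv X t : ℝ) : ℂ) + (ξ t : ℂ) * ((deriv (deriv X) t : ℝ) : ℂ) := by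
    exact_mod_cast hθ₂
  have cX : (ω₀ : ℂ) * ((deriv X t : ℝ) : ℂ) = (ξ t : ℂ) := by
    have h : ω₀ * deriv X t = ξ t := by rw [hX t]; field_simp
    exact_mod_cast h
  have cξ : 2 * (ω₀ : ℂ) * ((deriv ξ t : ℝ) : ℂ) = -((deriv q (X t) : ℝ) : ℂ) := by
    have h : 2 * ω₀ * deriv ξ t = -(deriv q (X t)) := by rw [hξ t]; field_simp
    exact_mod_cast h
  have cΓ : (ω₀ : ℂ) * deriv Γ t = (((deriv ξ t : ℝ) : ℂ) - Γ t * ((deriv X t : ℝ) : ℂ)) ^ 2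
      - Γ t ^ 2 - ((iteratedDeriv 2 q (X t) : ℝ) : ℂ) / 2 := by
    rw [hΓ t]; push_cast; ring
  have key := beam_residual_algebra (μ : ℂ) ω₀ ((deriv θ t : ℝ) : ℂ) ((deriv (deriv θ) t : ℝ) : ℂ)
    (ξ t) ((deriv ξ t : ℝ) : ℂ) ((deriv (deriv ξ) t : ℝ) : ℂ) ((deriv X t : ℝ) : ℂ)
    ((deriv (deriv X) t : ℝ) : ℂ) ((x : ℂ) - X t) (q (X t)) ((deriv q (X t) : ℝ) : ℂ)
    ((iteratedDeriv 2 q (X t) : ℝ) : ℂ) (q x) (Γ t) (deriv Γ t) (deriv (deriv Γ) t) (a t) (deriv a t)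
    (deriv (deriv a) t) ccons cθ cθ₂ cX cξ cΓ (ha t)
  dsimp only at key
  have hcast : (((q x - q (X t) - deriv q (X t) * (x - X t)
      - iteratedDeriv 2 q (X t) / 2 * (x - X t) ^ 2 : ℝ) : ℂ))
      = (q x : ℂ) - (q (X t) : ℂ) - ((deriv q (X t) : ℝ) : ℂ) * ((x : ℂ) - X t)
        - ((iteratedDeriv 2 q (X t) : ℝ) : ℂ) / 2 * ((x : ℂ) - X t) ^ 2 := by
    push_cast; ring
  rw [hcast]
  linear_combination
    cexp (I * μ * ((θ t : ℂ) + (ξ t : ℂ) * ((x : ℂ) - X t) + Γ t / 2 * ((x : ℂ) - X t) ^ 2)) * key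

end Residual

end Literature.Analysis.PDE
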